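import Summits.QuantumFields.YangMills.Theorems.BalabanUVNodesK0Stub1FlatAveragingDictionaryLevels
import Literature.MathematicalPhysics.QuantumFieldTheory.TiltedExponentMorseBounds

/-!
# K0⁷ STUB 1 (`stub_prop8StepCoP13`), sub-target S4a — **THE CORRECTED-CURRENT JUNCTION**: the record's criticality in chart coordinates
# (tests in the RECORD's multi-level kernel `{δ : Q_j(1)δ = 0 on Λ_j}`, Hessian letter «Δ(1)A′» co-closed) ⟹ print's (128) = p595460's `h128` VERBATIM
# (tests in `ker Q_V`, letter `Δ_aA′`) for the CORRECTED CURRENT `W′ = W + RᵀW`, `Rᵀ` = the skew part of the Frobenius transpose of `∂∘T`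
# (`T` = the multi-level dictionary's gauge map, p617458) — an ℝ-LINEAR, skew-valued map on fine fields

Cell `pub-ymgap`, width seat `pub-ymgap-k0-s1-w1` g5 (CLAIM-2 ∕ INTENT-2, bus I.32159 ∕ I.32185; HANDOFF § g4 (t1)(ii), the S4a half of dag-n07-e g20's (Q2)
`h128`-transfer chain I.31136).  `--kind proof --supports stmt-QuantumFields-20541 --as helper`; count-neutral.
[15] = [Balaban1985Variational]; [B6] = [Balaban1984PropagatorsII].

WHY.  The heart of [15] Sect. F at NODE 00 (p595460 `eq158_flatOps_matrixFields` → p596821∕p604735 → p608822∕p612312, the A₁ line) displays print's (128) as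
`h128 : ∀ δ skew, Q_Vδ = 0 → Σ_j Re tr(δ_jᴴ((Δ_VA′)_j + (WA′)_j)) = 0` — tests in PRINT's multi-level kernel.  The record's criticality, pulled back by dag-n07-w2's chart
(47), tests the RECORD's kernel (`Q_j(1) = dIterL j 1` on the index bonds, `fderiv_msChart_apply_eq_zero_iff`) with the flat Hessian «Δ(1) = ∂*∂» ([15] (127) p.297).
File B (p617458) carries every `Z ∈ ker Q_V` into the record's kernel by a pure gauge `∂(TZ)`; a pure gauge pairs to zero against a co-closed «Δ(1)A′» but NOT against the
current `W`, whence the correction `⟪Z, RᵀW⟫ := ⟪∂(TZ), W⟫` (HANDOFF § g4 I.30705 (2)); and on `ker Q_V` under the slice (153) `R∂*A′ = 0` one may «replace Δ by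
Δ_a = Δ + ∂R∂* + Q*aQ» (print p.297, [B6] (2.19)) — displayed here as `hDK`.

WHAT IS PROVED (sorry-free; no definition; axioms standard; `M = M_N(ℂ)`; `⟪X, Y⟫ := Σ_b Re tr(X_bᴴ Y_b)` spelled inline; «skew» = `X_bᴴ = −X_b`).
* §1 the real Frobenius form (symmetry = the tree's `OneLinkLaplace.re_trace_conjTranspose_mul_comm`, reused): `re_trace_conjTranspose_mul_self` (`Re tr(XᴴX) = Σ_{ij} |X_{ij}|²`),
  `eq_zero_of_pairing_eq_zero` (non-degeneracy), `pairing_conjTranspose_right_of_skew` (for skew `δ`: `⟪δ, rᴴ⟫ = −⟪δ, r⟫`), `pairing_add_left` ∕ `pairing_add_right` ∕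
  `pairing_smul_right` ∕ `pairing_sub_right` (bilinearity bookkeeping).
* §2 ★★ `exists_transpose_pairing` — every ℝ-linear `S` on fine fields has an ℝ-linear Frobenius transpose `Sᵀ`: `⟪Z, SᵀW⟫ = ⟪SZ, W⟫` (`LinearMap.BilinForm.toDual`).
* §3 ★★★ `exists_correctedCurrent` — for every nested `D` with the collar property: an ℝ-LINEAR, SKEW-valued `Rᵀ` with `⟪δ, RᵀW⟫ = ⟪∂(Tδ), W⟫` for skew `δ` (`T` = p617458's gauge
  map) such that for ALL data `(DVA, Kf, Wf)` and p595460's kernel-formula letter `QV`: (hK) `⟪∂μ, Kf⟫ = 0` for skew `μ`, (hDK) `⟪δ, DVA⟫ = ⟪δ, Kf⟫` for skew `δ ∈ ker Q_V`,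
  (h127rec) `⟪δ, Kf + Wf⟫ = 0` for skew `δ` in the RECORD's kernel ⟹ `h128` VERBATIM: `∀ δ skew, QVδ = 0 → Σ_j Re tr(δ_jᴴ(DVA_j + (Wf_j + (RᵀWf)_j))) = 0`;
  ★★ `exists_correctedCurrent_lieSU` (𝔰𝔲(N)-valued tests on both sides — p604735's letter shape).
HONEST SCOPE.  Finite-dimensional real linear algebra + file B by name; NO estimate: the (98)-slot letter of `W′ = W + RᵀW` needs `‖Rᵀ‖` (an `ℓ¹`-column count of
`∂∘T`, the S4b supplier's), NOT bounded here; `hK`∕`hDK` are DISPLAYED (their discharge from [B6] (2.19) as typed in `B6SectAVectorModelV1` + n07-w3's (153) `RE … = 0`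
shape is a sequel); nothing of Bałaban's analysis asserted; `stub_prop8StepCoP13` ∕ K0⁷ NOT closed; N07 NOT discharged; counts unmoved (28∕28 · 5∕27); one finite 𝕋⁴
programme at fixed ε — R4 closes the conditional finite-𝕋⁴ rung `BalabanLadder.UV` only, never the summit; the YM mass gap (Clay) is NOT proved by any of this; nothing
continuum ∕ ℝ⁴ ∕ OS.  No `sorry`, no `def`, no `instance`, no `notation`.

References: [15] (127)–(128) p.297, (44)–(47) p.285, (153) p.301, (158) p.302; [B6] (2.6)–(2.7) p.224, (2.19)–(2.20) p.226.
-/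

set_option autoImplicit false
noncomputable section
open scoped BigOperators Matrix Matrix.Norms.L2Operator

namespace Summit.QuantumFields.YangMills.Theorems.K0Stub1CorrectedCurrentJunction

open Literature.MathematicalPhysics.QuantumFieldTheory.Balaban1983to89
open LatticeFieldCalculus (bondAvgIter)
open B6SectADomainsV1 (Domains)
open B6SectAOperatorsV1 (BondIdx QE)
open Node00 (dIterL)
open T4AdjointCovarianceUnitary (lieSU mem_lieSU_iff)
open Literature.MathematicalPhysics.QuantumFieldTheory.OneLinkLaplace (re_trace_conjTranspose_mul_comm)
open Summit.QuantumFields.YangMills.Theorems.K0Stub1FlatAveragingDictionaryLevels (exists_linear_gauge_dIterL_one_eq_zero_of_bondAvgIter_eq_zero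
  lamSite_or_of_lamBond)

variable {P : Params} {N : ℕ}

/-! ## §1  The real Frobenius form `⟪X, Y⟫ = Σ_b Re tr(X_bᴴ Y_b)` on fine matrix fields -/

/-- `Re tr(AᴴA) = Σ_{ij} |A_{ij}|²`. [folklore] -/
theorem re_trace_conjTranspose_mul_self (A : Matrix (Fin N) (Fin N) ℂ) : (Aᴴ * A).trace.re = ∑ i, ∑ j, Complex.normSq (A j i) := by
  simp only [Matrix.trace, Matrix.diag, Matrix.mul_apply, Matrix.conjTranspose_apply, Complex.re_sum]
  refine Finset.sum_congr rfl fun i _ => Finset.sum_congr rfl fun j _ => ?_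
  rw [Complex.star_def, ← Complex.normSq_eq_conj_mul_self, Complex.ofReal_re]

/-- NON-DEGENERACY of the Frobenius form on fine fields: `⟪X, Y⟫ = 0` for all `Y` forces `X = 0`. [folklore] -/
theorem eq_zero_of_pairing_eq_zero {ι : Type*} [Fintype ι] (X : ι → Matrix (Fin N) (Fin N) ℂ)
    (h : ∀ Y : ι → Matrix (Fin N) (Fin N) ℂ, ∑ b, ((X b)ᴴ * Y b).trace.re = 0) : X = 0 := by
  have hself := h X
  simp only [re_trace_conjTranspose_mul_self] at hself
  have hb : ∀ b, ∑ i, ∑ j, Complex.normSq (X b j i) = 0 := fun b =>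
    (Finset.sum_eq_zero_iff_of_nonneg fun b _ => Finset.sum_nonneg fun i _ => Finset.sum_nonneg fun j _ => Complex.normSq_nonneg _).1 hself b
      (Finset.mem_univ b)
  funext b
  ext j i
  have hi := (Finset.sum_eq_zero_iff_of_nonneg fun i _ => Finset.sum_nonneg fun j _ => Complex.normSq_nonneg _).1 (hb b) i (Finset.mem_univ i)
  have hj := (Finset.sum_eq_zero_iff_of_nonneg fun j _ => Complex.normSq_nonneg _).1 hi j (Finset.mem_univ j)
  exact Complex.normSq_eq_zero.1 hj

/-- For a SKEW test `δ` and any `r`: `⟪δ, rᴴ⟫ = −⟪δ, r⟫` — hence the skew part `½(r − rᴴ)` pairs against skew tests exactly like `r`. [folklore] -/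
theorem pairing_conjTranspose_right_of_skew {ι : Type*} [Fintype ι] {δ : ι → Matrix (Fin N) (Fin N) ℂ} (hδ : ∀ b, (δ b)ᴴ = -δ b)
    (r : ι → Matrix (Fin N) (Fin N) ℂ) : ∑ b, ((δ b)ᴴ * (r b)ᴴ).trace.re = -∑ b, ((δ b)ᴴ * r b).trace.re := by
  rw [← Finset.sum_neg_distrib]
  refine Finset.sum_congr rfl fun b _ => ?_
  rw [← Matrix.conjTranspose_mul, Matrix.trace_conjTranspose, Complex.star_def, Complex.conj_re, Matrix.trace_mul_comm, hδ, Matrix.neg_mul,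
    Matrix.trace_neg, Complex.neg_re, neg_neg]

/-- The pairing is additive in the left slot. [folklore] -/
theorem pairing_add_left {ι : Type*} [Fintype ι] (X X' Y : ι → Matrix (Fin N) (Fin N) ℂ) :
    ∑ b, ((X b + X' b)ᴴ * Y b).trace.re = ∑ b, ((X b)ᴴ * Y b).trace.re + ∑ b, ((X' b)ᴴ * Y b).trace.re := by
  rw [← Finset.sum_add_distrib]
  refine Finset.sum_congr rfl fun b _ => ?_
  rw [Matrix.conjTranspose_add, Matrix.add_mul, Matrix.trace_add, Complex.add_re]

/-- The pairing is additive in the right slot. [folklore] -/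
theorem pairing_add_right {ι : Type*} [Fintype ι] (X Y Y' : ι → Matrix (Fin N) (Fin N) ℂ) :
    ∑ b, ((X b)ᴴ * (Y b + Y' b)).trace.re = ∑ b, ((X b)ᴴ * Y b).trace.re + ∑ b, ((X b)ᴴ * Y' b).trace.re := by
  rw [← Finset.sum_add_distrib]
  refine Finset.sum_congr rfl fun b _ => ?_
  rw [Matrix.mul_add, Matrix.trace_add, Complex.add_re]

/-- The pairing commutes with real scalars in the right slot. [folklore] -/
theorem pairing_smul_right {ι : Type*} [Fintype ι] (a : ℝ) (X Y : ι → Matrix (Fin N) (Fin N) ℂ) :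
    ∑ b, ((X b)ᴴ * (a • Y b)).trace.re = a * ∑ b, ((X b)ᴴ * Y b).trace.re := by
  rw [Finset.mul_sum]
  refine Finset.sum_congr rfl fun b _ => ?_
  rw [Matrix.mul_smul, Matrix.trace_smul, Complex.real_smul, Complex.re_ofReal_mul]

/-- The pairing of a difference in the right slot. [folklore] -/
theorem pairing_sub_right {ι : Type*} [Fintype ι] (X Y Y' : ι → Matrix (Fin N) (Fin N) ℂ) :
    ∑ b, ((X b)ᴴ * (Y b - Y' b)).trace.re = ∑ b, ((X b)ᴴ * Y b).trace.re - ∑ b, ((X b)ᴴ * Y' b).trace.re := by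
  rw [← Finset.sum_sub_distrib]
  refine Finset.sum_congr rfl fun b _ => ?_
  rw [Matrix.mul_sub, Matrix.trace_sub, Complex.sub_re]

/-! ## §2  The Frobenius transpose of a real-linear map on fine fields -/

/-- ★★ **EVERY ℝ-LINEAR MAP ON FINE FIELDS HAS A FROBENIUS TRANSPOSE**: `⟪Z, SᵀW⟫ = ⟪SZ, W⟫` (finite dimension; the form is non-degenerate, `LinearMap.BilinForm.toDual`).
[folklore] -/
theorem exists_transpose_pairing {ι : Type*} [Fintype ι] (S : (ι → Matrix (Fin N) (Fin N) ℂ) →ₗ[ℝ] (ι → Matrix (Fin N) (Fin N) ℂ)) :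
    ∃ St : (ι → Matrix (Fin N) (Fin N) ℂ) →ₗ[ℝ] (ι → Matrix (Fin N) (Fin N) ℂ),
      ∀ Z W : ι → Matrix (Fin N) (Fin N) ℂ, ∑ b, ((Z b)ᴴ * St W b).trace.re = ∑ b, ((S Z b)ᴴ * W b).trace.re := by
  classical
  -- the Frobenius form as a real bilinear form
  let B : LinearMap.BilinForm ℝ (ι → Matrix (Fin N) (Fin N) ℂ) :=
    LinearMap.mk₂ ℝ (fun X Y => ∑ b, ((X b)ᴴ * Y b).trace.re)
      (fun X X' Y => pairing_add_left X X' Y)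
      (fun a X Y => by
        have h : ∑ b, (((a • X) b)ᴴ * Y b).trace.re = ∑ b, ((Y b)ᴴ * (a • X b)).trace.re :=
          Finset.sum_congr rfl fun b _ => re_trace_conjTranspose_mul_comm _ _
        rw [h, pairing_smul_right, smul_eq_mul]
        congr 1
        exact Finset.sum_congr rfl fun b _ => re_trace_conjTranspose_mul_comm _ _)
      (fun X Y Y' => pairing_add_right X Y Y')
      (fun a X Y => by rw [smul_eq_mul]; exact pairing_smul_right a X Y)
  have hB : ∀ X Y, B X Y = ∑ b, ((X b)ᴴ * Y b).trace.re := fun _ _ => rfl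
  have hBsymm : ∀ X Y, B X Y = B Y X := fun X Y => by
    rw [hB, hB]; exact Finset.sum_congr rfl fun b _ => re_trace_conjTranspose_mul_comm _ _
  have hnd : B.Nondegenerate := by
    refine ⟨fun X hX => eq_zero_of_pairing_eq_zero X fun Y => hX Y, fun Y hY => eq_zero_of_pairing_eq_zero Y fun X => ?_⟩
    rw [← hB, hBsymm]; exact hY X
  refine ⟨(B.toDual hnd).symm.toLinearMap ∘ₗ LinearMap.lcomp ℝ ℝ S ∘ₗ (B.toDual hnd).toLinearMap, fun Z W => ?_⟩
  rw [← hB, ← hB, hBsymm Z, hBsymm (S Z)]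
  simp only [LinearMap.comp_apply, LinearEquiv.coe_coe]
  rw [LinearMap.BilinForm.apply_toDual_symm_apply, LinearMap.lcomp_apply, LinearMap.BilinForm.toDual_def]

/-! ## §3  The corrected current: the record's (127) ⟹ print's (128) = p595460's `h128` -/

section Main

variable [NeZero N] (D : Domains P)
  (hcollar : ∀ (i : ℕ) (e : PBond P (i + 1)), D.LamBond (i + 1) e → ∀ z : Site P i, (blockOf z = e.src ∨ blockOf z = e.tgt) → z ∈ D.Om i)

include hcollar in
/-- ★★★ **THE CORRECTED-CURRENT JUNCTION.**  For every nested family `D` with the collar property there are the multi-level dictionary's gauge map `T` (p617458: ℂ-linear,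
skew ↦ skew, sup letter `(d+2)L^{k+1}`) and an ℝ-LINEAR, SKEW-valued map `Rᵀ` on fine fields with `⟪δ, RᵀW⟫ = ⟪∂(Tδ), W⟫` for every skew `δ` (the skew part of the
Frobenius transpose of `∂∘T`) such that, for p595460's kernel-formula letter `QV` and ALL data `DVA` («Δ_aA′»), `Kf` («Δ(1)A′») and `Wf` («W(A′)»):
(hK) `⟪∂μ, Kf⟫ = 0` for every skew `μ`, (hDK) `⟪δ, DVA⟫ = ⟪δ, Kf⟫` for every skew `δ` with `QVδ = 0` ([15] p.297 «we can replace Δ by Δ_a», [B6] (2.19) on the slice (153)),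
and the SOCKET (h127rec) `⟪δ, Kf + Wf⟫ = 0` for every skew `δ` of the RECORD's multi-level kernel (`Q_j(1)δ = 0` on every `Λ_j`-bond) IMPLY p595460's `h128` for the
corrected current: `⟪δ, DVA + (Wf + RᵀWf)⟫ = 0` for every skew `δ` with `QVδ = 0`.
[cite: Balaban1985Variational, (127)-(128) p.297, (44)-(47) p.285, (158) p.302; Balaban1984PropagatorsII, (2.6)-(2.7) p.224, (2.19)-(2.20) p.226] -/
theorem exists_correctedCurrent :
    ∃ (T : (PBond P 0 → Matrix (Fin N) (Fin N) ℂ) →ₗ[ℂ] (Site P 0 → Matrix (Fin N) (Fin N) ℂ))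
      (Rt : (PBond P 0 → Matrix (Fin N) (Fin N) ℂ) →ₗ[ℝ] (PBond P 0 → Matrix (Fin N) (Fin N) ℂ)),
      (∀ Z : PBond P 0 → Matrix (Fin N) (Fin N) ℂ, (∀ b, (Z b)ᴴ = -Z b) → ∀ x, (T Z x)ᴴ = -T Z x) ∧
      (∀ (Z : PBond P 0 → Matrix (Fin N) (Fin N) ℂ) (s : ℝ), 0 ≤ s → (∀ b, ‖Z b‖ ≤ s) →
        ∀ x, ‖T Z x‖ ≤ ((P.d + 2 : ℕ) : ℝ) * (P.L : ℝ) ^ (D.k + 1) * s) ∧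
      (∀ W b, (Rt W b)ᴴ = -(Rt W b)) ∧
      (∀ δ W : PBond P 0 → Matrix (Fin N) (Fin N) ℂ, (∀ b, (δ b)ᴴ = -δ b) →
        ∑ b, ((δ b)ᴴ * Rt W b).trace.re = ∑ b, ((T δ b.tgt - T δ b.src)ᴴ * W b).trace.re) ∧
      ∀ {instDE : DecidableEq (PBond P 0)} {QV : (PBond P 0 → Matrix (Fin N) (Fin N) ℂ) →ₗ[ℂ] (BondIdx D → Matrix (Fin N) (Fin N) ℂ)},
        (∀ (A : PBond P 0 → Matrix (Fin N) (Fin N) ℂ) (t : BondIdx D),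
          QV A t = ∑ j, ((WithLp.ofLp (QE D (WithLp.toLp 2 (Pi.single j 1))) t : ℝ) : ℂ) • A j) →
        ∀ (DVA Kf Wf : PBond P 0 → Matrix (Fin N) (Fin N) ℂ),
          (∀ μ : Site P 0 → Matrix (Fin N) (Fin N) ℂ, (∀ x, (μ x)ᴴ = -μ x) → ∑ b, ((μ b.tgt - μ b.src)ᴴ * Kf b).trace.re = 0) →
          (∀ δ : PBond P 0 → Matrix (Fin N) (Fin N) ℂ, (∀ b, (δ b)ᴴ = -δ b) → QV δ = 0 →
            ∑ b, ((δ b)ᴴ * DVA b).trace.re = ∑ b, ((δ b)ᴴ * Kf b).trace.re) →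
          (∀ δ : PBond P 0 → Matrix (Fin N) (Fin N) ℂ, (∀ b, (δ b)ᴴ = -δ b) →
            (∀ (j : ℕ) (c : PBond P j), D.LamBond j c → dIterL j (1 : PBond P 0 → Matrix (Fin N) (Fin N) ℂ) δ c = 0) →
            ∑ b, ((δ b)ᴴ * (Kf b + Wf b)).trace.re = 0) →
          ∀ δ : PBond P 0 → Matrix (Fin N) (Fin N) ℂ, (∀ b, (δ b)ᴴ = -δ b) → QV δ = 0 →
            ∑ b, ((δ b)ᴴ * (DVA b + (Wf b + Rt Wf b))).trace.re = 0 := by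
  classical
  -- the multi-level dictionary, reading (2.3)
  obtain ⟨T, hTskew, -, -, -, -, hTletter, hTker⟩ := exists_linear_gauge_dIterL_one_eq_zero_of_bondAvgIter_eq_zero (N := N) D hcollar
    (fun j b => D.LamBond j b) (fun j b hb => lamSite_or_of_lamBond D hb) (fun j c hs ht => ⟨Or.inl hs.1, hs.2, ht.2⟩)
  -- the real-linear map `S = ∂ ∘ T` and its Frobenius transpose
  let S : (PBond P 0 → Matrix (Fin N) (Fin N) ℂ) →ₗ[ℝ] (PBond P 0 → Matrix (Fin N) (Fin N) ℂ) :=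
    { toFun := fun Z b => T Z b.tgt - T Z b.src
      map_add' := fun Z Z' => by funext b; simp only [map_add, Pi.add_apply]; abel
      map_smul' := fun a Z => by
        funext b
        simp only [RingHom.id_apply, Pi.smul_apply]
        rw [← Complex.coe_smul, map_smul, Pi.smul_apply, Pi.smul_apply, Complex.coe_smul, Complex.coe_smul, smul_sub] }
  have hS : ∀ Z b, S Z b = T Z b.tgt - T Z b.src := fun _ _ => rfl
  obtain ⟨St, hSt⟩ := exists_transpose_pairing S
  -- the skew part in the values
  let skw : (PBond P 0 → Matrix (Fin N) (Fin N) ℂ) →ₗ[ℝ] (PBond P 0 → Matrix (Fin N) (Fin N) ℂ) :=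
    { toFun := fun X b => (1 / 2 : ℝ) • (X b - (X b)ᴴ)
      map_add' := fun X X' => by funext b; simp only [Pi.add_apply, Matrix.conjTranspose_add]; rw [← smul_add]; congr 1; abel
      map_smul' := fun a X => by
        funext b
        simp only [Pi.smul_apply, RingHom.id_apply, Matrix.conjTranspose_smul, star_trivial]
        rw [← smul_sub, smul_comm] }
  have hskw : ∀ X b, skw X b = (1 / 2 : ℝ) • (X b - (X b)ᴴ) := fun _ _ => rfl
  refine ⟨T, skw ∘ₗ St, fun Z hZ x => ?_, hTletter, fun W b => ?_, fun δ W hδ => ?_, ?_⟩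
  · -- `T` preserves skewness (file B, `star` = `ᴴ`)
    have h := hTskew Z (fun b => by rw [Matrix.star_eq_conjTranspose]; exact hZ b) x
    rwa [Matrix.star_eq_conjTranspose] at h
  · -- `Rᵀ` is skew-valued
    rw [LinearMap.comp_apply, hskw, Matrix.conjTranspose_smul, star_trivial, Matrix.conjTranspose_sub, Matrix.conjTranspose_conjTranspose, ← smul_neg, neg_sub]
  · -- the transpose identity on skew tests
    have h1 : ∑ b, ((δ b)ᴴ * (skw ∘ₗ St) W b).trace.re = ∑ b, ((δ b)ᴴ * St W b).trace.re := by
      have h2 : ∑ b, ((δ b)ᴴ * (skw ∘ₗ St) W b).trace.re = (1 / 2 : ℝ) * ∑ b, ((δ b)ᴴ * (St W b - (St W b)ᴴ)).trace.re := by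
        rw [← pairing_smul_right]; rfl
      rw [h2, pairing_sub_right, pairing_conjTranspose_right_of_skew hδ]
      ring
    rw [h1, hSt]
    simp only [hS]
  · -- the junction
    intro instDE QV hQV DVA Kf Wf hK hDK h127 δ hδ hQ
    have hδ' : ∀ b, star (δ b) = -δ b := fun b => by rw [Matrix.star_eq_conjTranspose]; exact hδ b
    -- `δ` lies in print's multi-level kernel
    have h0' := (K0Stub1FlatAveragingDictionary.QV_eq_zero_iff D hQV δ).1 hQ
    have h0 : ∀ (j : ℕ) (c : PBond P j), D.LamBond j c → bondAvgIter j δ c = 0 := fun j c hc =>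
      h0' ⟨⟨⟨j, Nat.lt_succ_of_le (D.le_of_lamBond hc)⟩, c⟩, hc⟩
    -- the regauged test is in the record's kernel; apply the socket there
    have hν : ∀ x, (T δ x)ᴴ = -T δ x := fun x => by
      have h := hTskew δ hδ' x; rwa [Matrix.star_eq_conjTranspose] at h
    have hsum : ∀ b, (δ b + (T δ b.tgt - T δ b.src))ᴴ = -(δ b + (T δ b.tgt - T δ b.src)) := fun b => by
      rw [Matrix.conjTranspose_add, Matrix.conjTranspose_sub, hδ, hν, hν]; abel
    have h1 := h127 (fun b => δ b + (T δ b.tgt - T δ b.src)) hsum (hTker δ hδ' h0)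
    rw [pairing_add_left, pairing_add_right, pairing_add_right, hK (T δ) hν, zero_add] at h1
    -- assemble
    rw [pairing_add_right, pairing_add_right, hDK δ hδ hQ]
    have h3 : ∑ b, ((δ b)ᴴ * (skw ∘ₗ St) Wf b).trace.re = ∑ b, ((T δ b.tgt - T δ b.src)ᴴ * Wf b).trace.re := by
      have h2 : ∑ b, ((δ b)ᴴ * (skw ∘ₗ St) Wf b).trace.re = (1 / 2 : ℝ) * ∑ b, ((δ b)ᴴ * (St Wf b - (St Wf b)ᴴ)).trace.re := by
        rw [← pairing_smul_right]; rfl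
      rw [h2, pairing_sub_right, pairing_conjTranspose_right_of_skew hδ, hSt]
      simp only [hS]
      ring
    rw [h3]
    linarith

include hcollar in
/-- ★★ **THE CORRECTED-CURRENT JUNCTION WITH 𝔰𝔲(N)-VALUED TESTS ON BOTH SIDES** (p604735's `h128` letter shape: tests `δ : PBond → 𝔰𝔲(N)` read in `M_N(ℂ)`; the socket's
tests are the 𝔰𝔲(N)-valued fields of the RECORD's multi-level kernel — dag-n07-w1's `qLin j 1 δ c = dIterL j 1 ↑δ c` convention, `qLin_one_apply`).  Same `T`, same `Rᵀ`.
[cite: Balaban1985Variational, (127)-(128) p.297, (3)-(4) p.278, (44)-(47) p.285; Balaban1984PropagatorsII, (2.19)-(2.20) p.226] -/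
theorem exists_correctedCurrent_lieSU :
    ∃ (T : (PBond P 0 → Matrix (Fin N) (Fin N) ℂ) →ₗ[ℂ] (Site P 0 → Matrix (Fin N) (Fin N) ℂ))
      (Rt : (PBond P 0 → Matrix (Fin N) (Fin N) ℂ) →ₗ[ℝ] (PBond P 0 → Matrix (Fin N) (Fin N) ℂ)),
      (∀ Z : PBond P 0 → Matrix (Fin N) (Fin N) ℂ, (∀ b, Z b ∈ lieSU (Fin N)) → ∀ x, T Z x ∈ lieSU (Fin N)) ∧
      (∀ (Z : PBond P 0 → Matrix (Fin N) (Fin N) ℂ) (s : ℝ), 0 ≤ s → (∀ b, ‖Z b‖ ≤ s) →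
        ∀ x, ‖T Z x‖ ≤ ((P.d + 2 : ℕ) : ℝ) * (P.L : ℝ) ^ (D.k + 1) * s) ∧
      (∀ W b, (Rt W b)ᴴ = -(Rt W b)) ∧
      (∀ δ W : PBond P 0 → Matrix (Fin N) (Fin N) ℂ, (∀ b, (δ b)ᴴ = -δ b) →
        ∑ b, ((δ b)ᴴ * Rt W b).trace.re = ∑ b, ((T δ b.tgt - T δ b.src)ᴴ * W b).trace.re) ∧
      ∀ {instDE : DecidableEq (PBond P 0)} {QV : (PBond P 0 → Matrix (Fin N) (Fin N) ℂ) →ₗ[ℂ] (BondIdx D → Matrix (Fin N) (Fin N) ℂ)},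
        (∀ (A : PBond P 0 → Matrix (Fin N) (Fin N) ℂ) (t : BondIdx D),
          QV A t = ∑ j, ((WithLp.ofLp (QE D (WithLp.toLp 2 (Pi.single j 1))) t : ℝ) : ℂ) • A j) →
        ∀ (DVA Kf Wf : PBond P 0 → Matrix (Fin N) (Fin N) ℂ),
          (∀ μ : Site P 0 → lieSU (Fin N),
            ∑ b, (((μ b.tgt : Matrix (Fin N) (Fin N) ℂ) - (μ b.src : Matrix (Fin N) (Fin N) ℂ))ᴴ * Kf b).trace.re = 0) →
          (∀ δ : PBond P 0 → lieSU (Fin N), QV (fun b => (δ b : Matrix (Fin N) (Fin N) ℂ)) = 0 →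
            ∑ b, (((δ b : Matrix (Fin N) (Fin N) ℂ))ᴴ * DVA b).trace.re = ∑ b, (((δ b : Matrix (Fin N) (Fin N) ℂ))ᴴ * Kf b).trace.re) →
          (∀ δ : PBond P 0 → lieSU (Fin N),
            (∀ (j : ℕ) (c : PBond P j), D.LamBond j c →
              dIterL j (1 : PBond P 0 → Matrix (Fin N) (Fin N) ℂ) (fun b => (δ b : Matrix (Fin N) (Fin N) ℂ)) c = 0) →
            ∑ b, (((δ b : Matrix (Fin N) (Fin N) ℂ))ᴴ * (Kf b + Wf b)).trace.re = 0) →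
          ∀ δ : PBond P 0 → lieSU (Fin N), QV (fun b => (δ b : Matrix (Fin N) (Fin N) ℂ)) = 0 →
            ∑ b, (((δ b : Matrix (Fin N) (Fin N) ℂ))ᴴ * (DVA b + (Wf b + Rt Wf b))).trace.re = 0 := by
  classical
  obtain ⟨T, hTskew, hTsu, -, -, -, hTletter, hTker⟩ := exists_linear_gauge_dIterL_one_eq_zero_of_bondAvgIter_eq_zero (N := N) D hcollar
    (fun j b => D.LamBond j b) (fun j b hb => lamSite_or_of_lamBond D hb) (fun j c hs ht => ⟨Or.inl hs.1, hs.2, ht.2⟩)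
  let S : (PBond P 0 → Matrix (Fin N) (Fin N) ℂ) →ₗ[ℝ] (PBond P 0 → Matrix (Fin N) (Fin N) ℂ) :=
    { toFun := fun Z b => T Z b.tgt - T Z b.src
      map_add' := fun Z Z' => by funext b; simp only [map_add, Pi.add_apply]; abel
      map_smul' := fun a Z => by
        funext b
        simp only [RingHom.id_apply, Pi.smul_apply]
        rw [← Complex.coe_smul, map_smul, Pi.smul_apply, Pi.smul_apply, Complex.coe_smul, Complex.coe_smul, smul_sub] }
  have hS : ∀ Z b, S Z b = T Z b.tgt - T Z b.src := fun _ _ => rfl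
  obtain ⟨St, hSt⟩ := exists_transpose_pairing S
  let skw : (PBond P 0 → Matrix (Fin N) (Fin N) ℂ) →ₗ[ℝ] (PBond P 0 → Matrix (Fin N) (Fin N) ℂ) :=
    { toFun := fun X b => (1 / 2 : ℝ) • (X b - (X b)ᴴ)
      map_add' := fun X X' => by funext b; simp only [Pi.add_apply, Matrix.conjTranspose_add]; rw [← smul_add]; congr 1; abel
      map_smul' := fun a X => by
        funext b
        simp only [Pi.smul_apply, RingHom.id_apply, Matrix.conjTranspose_smul, star_trivial]
        rw [← smul_sub, smul_comm] }
  have hskw : ∀ X b, skw X b = (1 / 2 : ℝ) • (X b - (X b)ᴴ) := fun _ _ => rfl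
  have htr : ∀ δ W : PBond P 0 → Matrix (Fin N) (Fin N) ℂ, (∀ b, (δ b)ᴴ = -δ b) →
      ∑ b, ((δ b)ᴴ * (skw ∘ₗ St) W b).trace.re = ∑ b, ((T δ b.tgt - T δ b.src)ᴴ * W b).trace.re := by
    intro δ W hδ
    have h2 : ∑ b, ((δ b)ᴴ * (skw ∘ₗ St) W b).trace.re = (1 / 2 : ℝ) * ∑ b, ((δ b)ᴴ * (St W b - (St W b)ᴴ)).trace.re := by
      rw [← pairing_smul_right]; rfl
    rw [h2, pairing_sub_right, pairing_conjTranspose_right_of_skew hδ, hSt]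
    simp only [hS]
    ring
  refine ⟨T, skw ∘ₗ St, hTsu, hTletter, fun W b => ?_, htr, ?_⟩
  · rw [LinearMap.comp_apply, hskw, Matrix.conjTranspose_smul, star_trivial, Matrix.conjTranspose_sub, Matrix.conjTranspose_conjTranspose, ← smul_neg, neg_sub]
  · intro instDE QV hQV DVA Kf Wf hK hDK h127 δ hQ
    -- the coerced test is skew and lies in print's multi-level kernel
    have hδ' : ∀ b, star ((δ b : Matrix (Fin N) (Fin N) ℂ)) = -(δ b : Matrix (Fin N) (Fin N) ℂ) := fun b => (mem_lieSU_iff.mp (δ b).2).1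
    have hδ : ∀ b, ((δ b : Matrix (Fin N) (Fin N) ℂ))ᴴ = -(δ b : Matrix (Fin N) (Fin N) ℂ) := fun b => by
      rw [← Matrix.star_eq_conjTranspose]; exact hδ' b
    have h0' := (K0Stub1FlatAveragingDictionary.QV_eq_zero_iff D hQV (fun b => (δ b : Matrix (Fin N) (Fin N) ℂ))).1 hQ
    have h0 : ∀ (j : ℕ) (c : PBond P j), D.LamBond j c → bondAvgIter j (fun b => (δ b : Matrix (Fin N) (Fin N) ℂ)) c = 0 := fun j c hc =>
      h0' ⟨⟨⟨j, Nat.lt_succ_of_le (D.le_of_lamBond hc)⟩, c⟩, hc⟩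
    -- the regauging gauge function is 𝔰𝔲(N)-valued; the regauged test as an 𝔰𝔲(N) field
    have hν : ∀ x, T (fun b => (δ b : Matrix (Fin N) (Fin N) ℂ)) x ∈ lieSU (Fin N) := hTsu _ fun b => (δ b).2
    let δ' : PBond P 0 → lieSU (Fin N) := fun b =>
      ⟨(δ b : Matrix (Fin N) (Fin N) ℂ) + (T (fun b => (δ b : Matrix (Fin N) (Fin N) ℂ)) b.tgt - T (fun b => (δ b : Matrix (Fin N) (Fin N) ℂ)) b.src),
        Submodule.add_mem _ (δ b).2 (Submodule.sub_mem _ (hν _) (hν _))⟩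
    have hδ'coe : (fun b => (δ' b : Matrix (Fin N) (Fin N) ℂ)) =
        fun b => (δ b : Matrix (Fin N) (Fin N) ℂ) + (T (fun b => (δ b : Matrix (Fin N) (Fin N) ℂ)) b.tgt - T (fun b => (δ b : Matrix (Fin N) (Fin N) ℂ)) b.src) := rfl
    have h1 := h127 δ' (by rw [hδ'coe]; exact hTker _ hδ' h0)
    have hδ'b : ∀ b, (δ' b : Matrix (Fin N) (Fin N) ℂ) =
        (δ b : Matrix (Fin N) (Fin N) ℂ) + (T (fun b => (δ b : Matrix (Fin N) (Fin N) ℂ)) b.tgt - T (fun b => (δ b : Matrix (Fin N) (Fin N) ℂ)) b.src) :=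
      fun b => rfl
    simp only [hδ'b] at h1
    rw [pairing_add_left, pairing_add_right, pairing_add_right] at h1
    have hKν := hK (fun x => ⟨T (fun b => (δ b : Matrix (Fin N) (Fin N) ℂ)) x, hν x⟩)
    rw [hKν, zero_add] at h1
    -- assemble
    rw [pairing_add_right, pairing_add_right, hDK δ hQ, htr _ Wf hδ]
    linarith

end Main

end Summit.QuantumFields.YangMills.Theorems.K0Stub1CorrectedCurrentJunction

end
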